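import Mathlib
import Summits.CriticalPhenomena.PercolationContinuityZ3.Theorems.PercNearOneGluingNoHeavyLowerTailOffSetTransfer
import Literature.Probability.LatticeModels.ProdBernoulliClusterLocality
import Literature.Probability.Percolation.SharpnessDCTProofs
import HarnessLib

/-!
# Crux `PercNearOneGluing.NoHeavyLowerTail` (stmt-CriticalPhenomena-4575), line `bhk-superadditivity-thinning` —
# stub `blockOffSetTransfer`: block form of the off-set reliability transfer

Lead prover-line-stmt-CriticalPhenomena-4575-c5-0, 2026-08-16.  Proves exactly the registered stub
signature `blockOffSetTransfer`; lands with `--supports stmt-CriticalPhenomena-4575`.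

## Content

Finite weighted graph on `Fin n`, weights `w : Sym2 (Fin n) → unitInterval`, an observer block `O`
and two vertices `a, b ∉ O`.  Two modified weight functions:

* `kill w O = fun e => if (∃ x ∈ e, x ∈ O) then 0 else w e` — the block `O` deleted;
* `glue w O = fun e => if (∀ x ∈ e, x ∈ O) ∧ ¬ e.IsDiag then 1 else w e` — the block `O` contracted.

The stub: (deadness of the relay `a` with the block DELETED) × (probability, under the glued law,
that NO vertex of `O` reaches `b`) ≤ (unreliability of `a` under the glued law),

  `P_{kill w O}(a ↮ b) · P_{glue w O}(O ↮ b) ≤ P_{glue w O}(a ↮ b)`.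

## Proof

Harris on two decreasing events, already packaged as `offSet_reliability_transfer'` (file
`…NoHeavyLowerTailOffSetTransfer.lean`) for the glued weights and `S = ↑O`:
`P_g(a ↮ b in Oᶜ) · P_g(O ↮ b) ≤ P_g(a ↮ b)`.  It remains to bound `P_k(a ↮ b) ≤ P_g(a ↮ b in Oᶜ)`:
`{a ↔ b in Oᶜ} ⊆ {a ↔ b}` gives `P_k(a ↮ b) ≤ P_k(a ↮ b in Oᶜ)`, and the event `{a ↮ b in Oᶜ}` is
determined by the pairs inside `Oᶜ` (`DCT16.determinedBy_openConnIn`), on which `kill w O` and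
`glue w O` both equal `w`, so `P_k(a ↮ b in Oᶜ) = P_g(a ↮ b in Oᶜ)`
(`prodBernoulli_real_eq_of_determinedBy`).
-/

namespace Summit.CriticalPhenomena.PercolationContinuityZ3.Theorems

open MeasureTheory Set
open Literature.Probability.LatticeModels (prodBernoulli prodBernoulli_real_eq_of_determinedBy)
open Literature.Probability.Percolation

/-- **Block off-set reliability transfer** (registered stub `blockOffSetTransfer` of crux
stmt-CriticalPhenomena-4575, line `bhk-superadditivity-thinning`).  For weights `w` on the pairs of
`Fin n`, a block `O` and `a, b ∉ O`:
`P_{kill w O}(a ↮ b) · P_{glue w O}(∀ o ∈ O, o ↮ b) ≤ P_{glue w O}(a ↮ b)`, where `kill w O` puts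
weight `0` on the pairs meeting `O` and `glue w O` puts weight `1` on the non-loop pairs inside `O`.
Proof: `offSet_reliability_transfer'` (Harris) for the glued weights and `S = O`, plus
`P_{kill}(a ↮ b) ≤ P_{kill}(a ↮ b in Oᶜ) = P_{glue}(a ↮ b in Oᶜ)`, the equality because the event
is determined by the pairs inside `Oᶜ`, where both weight functions equal `w`. [folklore] -/
theorem blockOffSetTransfer : ∀ (n : ℕ) (w : Sym2 (Fin n) → unitInterval) (O : Finset (Fin n)) (a b : Fin n), a ∉ O → b ∉ O → (Literature.Probability.LatticeModels.prodBernoulli (fun e : Sym2 (Fin n) => if (∃ x ∈ e, x ∈ O) then 0 else w e)).real (Literature.Probability.Percolation.openConn a b)ᶜ * (Literature.Probability.LatticeModels.prodBernoulli (fun e : Sym2 (Fin n) => if (∀ x ∈ e, x ∈ O) ∧ ¬ e.IsDiag then 1 else w e)).real {ω : Literature.Probability.Percolation.BondConfig (Fin n) | ∀ o ∈ O, ω ∉ Literature.Probability.Percolation.openConn o b} ≤ (Literature.Probability.LatticeModels.prodBernoulli (fun e : Sym2 (Fin n) => if (∀ x ∈ e, x ∈ O) ∧ ¬ e.IsDiag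 then 1 else w e)).real (Literature.Probability.Percolation.openConn a b)ᶜ := by
  intro n w O a b _ _
  -- the two weight functions and the set of pairs avoiding the block
  set k : Sym2 (Fin n) → unitInterval := fun e => if (∃ x ∈ e, x ∈ O) then 0 else w e with hk
  set g : Sym2 (Fin n) → unitInterval :=
    fun e => if (∀ x ∈ e, x ∈ O) ∧ ¬ e.IsDiag then 1 else w e with hg
  set S : Set (Fin n) := ((↑O : Set (Fin n)))ᶜ with hS
  -- (1) Harris, for the glued weights and the vertex set `↑O`
  have h1 : (prodBernoulli g).real (openConnIn S a b)ᶜ *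
      (prodBernoulli g).real {ω : BondConfig (Fin n) | ∀ o ∈ O, ω ∉ openConn o b}
        ≤ (prodBernoulli g).real (openConn a b)ᶜ := by
    have h := offSet_reliability_transfer' g (↑O : Set (Fin n)) a b
    simpa only [Finset.mem_coe] using h
  -- (2a) `{a ↔ b in S} ⊆ {a ↔ b}`, so the complements reverse
  have h2a : (prodBernoulli k).real (openConn a b)ᶜ ≤ (prodBernoulli k).real (openConnIn S a b)ᶜ := by
    refine measureReal_mono (Set.compl_subset_compl.2 fun ω hω => ?_)
    exact DCT16.reachable_of_pathIn (DCT16.pathIn_of_mem_openConnIn hω)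
  -- (2b) `{a ↮ b in S}` is determined by the pairs inside `S`, where `k = g = w`
  have hkg : ∀ e ∈ S.sym2, k e = g e := by
    intro e he
    induction e using Sym2.ind with
    | h x y =>
      obtain ⟨hx, hy⟩ := Set.mk_mem_sym2_iff.1 he
      simp only [hS, Set.mem_compl_iff, Finset.mem_coe] at hx hy
      simp [hk, hg, Sym2.mem_iff, hx, hy]
  have hdet : DeterminedBy (openConnIn S a b)ᶜ S.sym2 :=
    (DCT16.determinedBy_openConnIn S a b subset_rfl).compl
  have hmeas : MeasurableSet ((openConnIn S a b)ᶜ : Set (BondConfig (Fin n))) :=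
    (measurableSet_openConnIn_of_countable S a b).compl
  have h2b : (prodBernoulli k).real (openConnIn S a b)ᶜ = (prodBernoulli g).real (openConnIn S a b)ᶜ :=
    prodBernoulli_real_eq_of_determinedBy k g hkg hdet hmeas
  -- chain
  calc (prodBernoulli k).real (openConn a b)ᶜ *
        (prodBernoulli g).real {ω : BondConfig (Fin n) | ∀ o ∈ O, ω ∉ openConn o b}
      ≤ (prodBernoulli g).real (openConnIn S a b)ᶜ *
          (prodBernoulli g).real {ω : BondConfig (Fin n) | ∀ o ∈ O, ω ∉ openConn o b} :=
        mul_le_mul_of_nonneg_right (h2a.trans_eq h2b) measureReal_nonneg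
    _ ≤ (prodBernoulli g).real (openConn a b)ᶜ := h1

end Summit.CriticalPhenomena.PercolationContinuityZ3.Theorems
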